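import Literature.NumberTheory.EllipticCurves.BSDSelmerCMPConverseKLevelProofs
import Literature.NumberTheory.EllipticCurves.BSDSelmerPConverseYanZhuKolyvaginSystemProofs
import HarnessLib

/-!
# Burungale–Tian, Thm. 1.2, along the printed proof of BCGS Cor. 1: Kolyvagin's conjecture
# (BCGS Thm. 1, a named fact) + the structure step + Gross–Zagier + reciprocity (named facts)

`Proofs` companion (theorems only: no definition, no new named fact) of
`Literature.NumberTheory.EllipticCurves.BSDSelmerCMPConverse` for the named fact
`Literature.NumberTheory.EllipticCurves.burungaleTian_analyticRank_eq_one_of_selmerCorank_eq_one_of_hasCM`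
(A. Burungale, Y. Tian, *`p`-converse to a theorem of Gross–Zagier, Kolyvagin and Rubin*, Invent.
Math. 220 (2020), Thm. 1.2: for a CM elliptic curve `E/ℚ` and a good ordinary prime `p > 3`,
`corank_{ℤ_p} Sel_{p^∞}(E/ℚ) = 1 ⇒ ord_{s=1} L(E, s) = 1`).

## What this file adds to `BSDSelmerCMPConverseKLevelProofs`

Route B (file `BSDSelmerCMPConverseHeegnerFieldProofs`; `…KLevelProofs`, Parts 3, 7, 8) proves
the fact from named facts of the tree and ONE inline input, the `K`-level corank-one
`p`-converse of Burungale–Castella–Grossi–Skinner, Camb. J. Math. 14 (2026) = arXiv:2312.09301,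
Cor. 1 (rank-one display, p. 4) for CM curves (`hBCGS_CM`). BCGS print the proof of Cor. 1 in one
sentence (§0.1, p. 4): *"The non-vanishing of the Kolyvagin system* [their Thm. 1] *in
combination with* [Kolyvagin, *On the structure of Selmer groups*, Math. Ann. 291 (1991)] *leads
to a link between the order of vanishing of the Kolyvagin system and the rank of the
`p^∞`-Selmer group of `E/K`"*, namely `ord(κ^{Heeg}) = max{r(E/K)⁺, r(E/K)⁻} − 1` (Cor. 1), and
*"In the rank one case it yields a `p`-converse to the Gross–Zagier and Kolyvagin theorem:
`corank_{ℤ_p} Sel_{p^∞}(E/K) = 1 ⟹ ord_{s=1} L(E/K, s) = 1`"* — the last step being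
`ord(κ^{Heeg}) = 0`, i.e. `κ_1^{Heeg} ≠ 0`, and (p. 3) *"by the Gross–Zagier formula,
`κ_1^{Heeg} ≠ 0` if and only if `L'(E/K, 1) ≠ 0`"*.

Since 2026-08-17 three of the four ingredients of that sentence are NAMED FACTS of the tree:

* (K1) BCGS **Thm. 1** (Kolyvagin's conjecture: some class `κ_n^{Heeg} ≠ 0`), stated under (irr),
  (tor), `p > 3` good ordinary, (Heeg), (disc), `p` split —
  `BurungaleEtAl2026_exists_kolyvaginClass_ne_zero` (file `HeegnerPointsKolyvaginStructure`). Its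
  hypotheses hold for a CM curve at a good ordinary `p ≥ 5` over a Hoffstein–Luo field: (irr) by
  Serre (`hasIrreducibleModPGaloisRep_of_hasCM_of_five_le`), (tor) from (irr) over a quadratic field
  (`torsionBy_eq_bot_of_hasIrreducibleModPGaloisRep`, file `…HeegnerFieldProofs`);
* the **Gross–Zagier** corollary `analyticRankEK_eq_one_iff_heegner_nonTorsion` (or the formula
  `gross_zagier` + Modularity) and **Shimura reciprocity at conductor `1`**,
  `heegnerPointOfConductor_one_galoisConj`, which together read the bottom class:
  `c_M(1) ≠ 0 ⇒ ord_{s=1} L(E/K, s) = 1`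
  (`heegnerSystem_analyticRankEK_eq_one_of_kolyvaginClass_one_ne_zero`, file
  `BSDSelmerPConverseYanZhuKolyvaginSystemProofs`, no hypothesis on the Galois image).

The fourth, Kolyvagin's STRUCTURE theorem, is in the tree as
`Kolyvagin1991_selmerCorank_of_kolyvaginClass_ne_zero` (K2) under its printed hypothesis
`ℓ ∈ B(E)`, i.e. `ρ̄_{E,p}` SURJECTIVE — which fails for every CM curve at a good ordinary `p > 3`
(`not_hasSurjectiveModNGaloisRep_of_hasCM_of_not_dvd_frobeniusTrace`, `…KLevelProofs` Part 5).
So for CM curves the structure step is exactly what BCGS assert beyond the letter of [Kolyvagin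
1991]: Cor. 1 is printed *"for `E`, `p` and `K` as in Theorem 1"* (no hypothesis on the image
beyond (irr)/(tor)), whereas Kolyvagin's Thm. 4 is printed for `ℓ ∈ B(E)` and Gross's exposition
assumes *"that the curve `E` does not have complex multiplication"* (Gross 1991, §2, p. 237).
This file therefore takes as its ONE inline input the printed conclusion of Cor. 1 itself — the
formula `ord(κ^{Heeg}) = max{r⁺, r⁻} − 1`, rendered in the vocabulary of (K2) as "at a non-zero
class `c_M(n)` of minimal depth `ν(n)`: `max{c, c'} = ν(n) + 1`", `c = corank_p Sel(E/ℚ) = r⁺`,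
`c' = corank_p Sel(E^{(d_K)}/ℚ) = r⁻` (odd `p`) — under the hypotheses of Thm. 1 in its
unconditional case `p > 3`, (irr) (`hCor1`), resp. for CM curves only (`hCor1_CM`), and proves:

* `heegnerSystem_exists_kolyvaginClass_one_ne_zero_of_max_eq` — pointwise: a non-zero class
  (Kolyvagin's conjecture at `(E, p, K)`) + the Cor. 1 formula at `(E, p, K)` + `c + c' = 1` ⇒ the
  BOTTOM class `c_M(1) ≠ 0` for some datum of conductor `1` (minimal depth `ν`; `max{c, c'} = 1`
  forces `ν = 0`, `n = 1`);
* `max_selmerCorank_eq_of_kolyvagin1991` — consistency: on curves with `ρ̄_{E,p}` onto, `p ≥ 5`,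
  the inline formula IS the conclusion of the named fact (K2) (its dichotomy gives `max = ν + 1`);
* `burungaleEtAl2026_analyticRankEK_eq_one_of_selmerCorank_eq_one_of_cor1` — BCGS Cor. 1,
  rank-one display, for EVERY `E/ℚ` under (irr), (tor), `p > 3` (the inline binder `hBCGS` shared
  by `BSDSelmerCMPConverseHeegnerFieldProofs` and `BSDSelmerPConverseYanZhuProofs`) from (K1), the
  Cor. 1 formula, Gross–Zagier and reciprocity;
  `burungaleEtAl2026_analyticRankEK_eq_one_of_hasCM_of_selmerCorank_eq_one_of_cor1CM` — the same
  for CM curves from the CM instances of the formula;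
* `burungaleTian_…_of_hasCM_of_cor1CM_of_nekovar` — **the fact** from the named facts
  `Nekovar2013_theoremA` (parity, printed input (4.2)), `ModularForms.exists_isNewformOf`,
  `HoffsteinLuo1997_exists_twist_L_one_ne_zero` (auxiliary field, (4.3)),
  `finite_point_of_hasCM_of_L_one_ne_zero` + `shaFinite_of_hasCM_of_L_one_ne_zero` (Coates–Wiles +
  Rubin 1987, the rank-zero factor (4.4)), (K1), Gross–Zagier, reciprocity, and the inline
  `hCor1_CM`; variants `…_of_cor1CM` (parity as `p_parity`, Kato for the twist),
  `…_of_cor1CM_of_gross_zagier` (the Gross–Zagier formula `gross_zagier` instead of its corollary),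
  `…_of_cor1_of_nekovar` (the general formula).

Outcome. Along this decomposition the fact rests on EIGHT named facts of the tree and one inline
input which is no longer a `p`-converse but the STRUCTURE statement of BCGS Cor. 1 for CM curves
(Kolyvagin side only; the analytic side — Gross–Zagier — and the identification of `P(1)` with
the Gross–Zagier point — reciprocity — enter by name). None of the eight has a `_holds` today, and the structure statement for CM
curves has no proof in print other than BCGS's pointer to [Kolyvagin 1991] (scope note above), so
`burungaleTian_analyticRank_eq_one_of_selmerCorank_eq_one_of_hasCM_holds` is not here.

## References

* [BurungaleTian2019] A. Burungale, Y. Tian, Invent. Math. 220 (2020) 211–253: Thm. 1.2 (p. 214),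
  §4.2.3 (pp. 249–250).
* [BurungaleEtAl2026] A. Burungale, F. Castella, G. Grossi, C. Skinner, Camb. J. Math. 14 (2026)
  = arXiv:2312.09301: Thm. 1 and Cor. 1 (§0.1, pp. 3–4).
* [Kolyvagin1991MathAnn] V. A. Kolyvagin, Math. Ann. 291 (1991) 253–259: §2, Thm. 4 (ℓ ∈ B(E)).
* [GrossLMS1991] B. H. Gross, LMS LNS 153 (1991) 235–256: §2 (p. 237: no CM), §4.
* [WZhang2014] W. Zhang, Camb. J. Math. 2 (2014): Thm. 1.2, Thm. 11.2 (i) ((sur)).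
* [GrossZagier1986] B. Gross, D. Zagier, Invent. Math. 84 (1986): Thm. I.6.3 with V.§2.
* [Nekovar2013] J. Nekovář, Algebra Number Theory 7 (2013): Thm. A.
* [HoffsteinLuo1997] J. Hoffstein, W. Luo, Math. Res. Lett. 4 (1997): Theorem (pp. 435–436).
* [CoatesWiles1977] J. Coates, A. Wiles, Invent. Math. 39 (1977): Thm. 1.
* [Rubin1987Sha] K. Rubin, Invent. Math. 89 (1987): Thm. A.
* [Kato2004Asterisque] K. Kato, Astérisque 295 (2004): Cor. 14.3.
* [DokchitserDokchitserAnnals2010] T. and V. Dokchitser, Ann. of Math. 172 (2010): Thm. 1.4.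
-/

noncomputable section

open scoped Classical

namespace Literature.NumberTheory.EllipticCurves

open ModularForms WeierstrassCurve

/-! ## Part 1. Kolyvagin's conjecture + the Cor. 1 formula at corank one: the bottom class -/

/-- **Kolyvagin's conjecture + BCGS Cor. 1's formula at `c + c' = 1`: the BOTTOM class `c_M(1)`
is non-zero for some datum of conductor `1`** (pointwise in `(E, p, K)`, fixed nothing). Given a
non-zero class `c_M(n)` of the Heegner Kolyvagin system of `(W, p, K)` at some square-free product
`n` of Kolyvagin primes and level `1 ≤ M ≤ M(n)` (`hex` — Kolyvagin's conjecture, BCGS Thm. 1, at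
`(E, p, K)`), and the formula of BCGS Cor. 1 at `(E, p, K)` in the form "at a non-zero class of
minimal depth `ν(n) = #{ℓ ∣ n}` one has `max{c, c'} = ν(n) + 1`" (`hmax`;
`c = corank_p Sel(E/ℚ)`, `c' = corank_p Sel(E^{(d_K)}/ℚ)`): if `c + c' = 1` then some class
`c_M(1)`, `M ≥ 1`, of a datum of conductor `1` is non-zero. Proof: minimise the depth of the given
class (`heegnerSystem_exists_minimal_kolyvaginClass_ne_zero`); there `max{c, c'} = ν + 1` with
`max{c, c'} ≤ c + c' = 1` forces `ν = 0`, so `n = 1` (`n` square-free, `n ≠ 0`). This is the step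
*"`ord(κ^{Heeg}) = max{r⁺, r⁻} − 1` … In the rank one case it yields …"* of BCGS, §0.1, p. 4.
[cite: BurungaleEtAl2026, Thm. 1 and Cor. 1 (arXiv:2312.09301, §0.1, pp. 3–4)] -/
theorem heegnerSystem_exists_kolyvaginClass_one_ne_zero_of_max_eq {W : WeierstrassCurve ℚ}
    [W.IsGloballyMinimal] [NeZero (W.conductorNorm ℤ)] {K : Type} [Field K] [NumberField K]
    {p : ℕ} (hp : p.Prime)
    (hex : ∃ (Dt : ModularParametrizationData W (W.conductorNorm ℤ)) (β : ℤ) (ι : K →+* ℂ) (n : ℕ)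
      (d : KolyvaginHeegnerData Dt β ι n) (M : ℕ),
      KolyvaginDescent.KolSupp (Zhang2014.IsKolyvaginPrime (W.conductorNorm ℤ) W K p) n ∧
        1 ≤ M ∧ (M : ℕ∞) ≤ Zhang2014.levelIndex W p n ∧ d.kolyvaginClass hp M ≠ 0)
    (hmax : ∀ (Dt : ModularParametrizationData W (W.conductorNorm ℤ)) (β : ℤ) (ι : K →+* ℂ) (n : ℕ)
      (d : KolyvaginHeegnerData Dt β ι n) (M : ℕ),
      KolyvaginDescent.KolSupp (Zhang2014.IsKolyvaginPrime (W.conductorNorm ℤ) W K p) n →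
      1 ≤ M → (M : ℕ∞) ≤ Zhang2014.levelIndex W p n → d.kolyvaginClass hp M ≠ 0 →
      (∀ (n' : ℕ) (d' : KolyvaginHeegnerData Dt β ι n') (M' : ℕ),
        KolyvaginDescent.KolSupp (Zhang2014.IsKolyvaginPrime (W.conductorNorm ℤ) W K p) n' →
        1 ≤ M' → (M' : ℕ∞) ≤ Zhang2014.levelIndex W p n' → d'.kolyvaginClass hp M' ≠ 0 →
        n.primeFactors.card ≤ n'.primeFactors.card) →
      max (W.selmerCorank p) ((W.quadraticTwist (NumberField.discr K : ℚ)).selmerCorank p) =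
        n.primeFactors.card + 1)
    (hcc : W.selmerCorank p + (W.quadraticTwist (NumberField.discr K : ℚ)).selmerCorank p = 1) :
    ∃ (Dt : ModularParametrizationData W (W.conductorNorm ℤ)) (β : ℤ) (ι : K →+* ℂ)
      (d : KolyvaginHeegnerData Dt β ι 1) (M : ℕ), 1 ≤ M ∧ d.kolyvaginClass hp M ≠ 0 := by
  obtain ⟨Dt, β, ι, n, d, M, hn, hM1, hMle, hne⟩ := hex
  -- a non-zero class of minimal depth
  obtain ⟨n₀, d₀, M₀, hn₀, hM₀, hM₀le, hne₀, hmin⟩ :=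
    heegnerSystem_exists_minimal_kolyvaginClass_ne_zero hp d hn hM1 hMle hne
  -- the Cor. 1 formula there: `max{c, c'} = ν + 1`, and `max{c, c'} ≤ c + c' = 1`
  have hν1 := hmax Dt β ι n₀ d₀ M₀ hn₀ hM₀ hM₀le hne₀ hmin
  have hν : n₀.primeFactors.card = 0 := by
    rcases max_choice (W.selmerCorank p)
        ((W.quadraticTwist (NumberField.discr K : ℚ)).selmerCorank p) with h | h <;>
      rw [h] at hν1 <;> omega
  have hn1 : n₀ = 1 := by
    rw [Finset.card_eq_zero, Nat.primeFactors_eq_empty] at hν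
    rcases hν with h0 | h1
    · exact absurd (h0 ▸ hn₀.1) not_squarefree_zero
    · exact h1
  subst hn1
  exact ⟨Dt, β, ι, d₀, M₀, hM₀, hne₀⟩

/-- **Consistency with the named structure theorem (K2): on curves with `ρ̄_{E,p}` onto the inline
formula is Kolyvagin's Thm. 4.** For `W/ℚ` globally minimal elliptic, `p ≥ 5` with `ρ̄_{E,p}`
surjective and good reduction at `p`, `K` imaginary quadratic with (Heeg) for `N_E`, `d_K` odd,
`d_K ≠ −3`, `p` split: at a non-zero class `c_M(n)` of minimal depth,
`Kolyvagin1991_selmerCorank_of_kolyvaginClass_ne_zero` (`hK2`; its hypotheses `d_K ≠ −4`,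
`p ∤ d_K`, `p ∤ N_E` follow from `d_K` odd, `p` split, good reduction) gives
`c = ν + 1 ∧ c' ≤ ν` or `c' = ν + 1 ∧ c ≤ ν`, whence `max{c, c'} = ν + 1` — BCGS's Cor. 1 at such a
class. [cite: Kolyvagin1991MathAnn, §2 Thm. 4]
[cite: BurungaleEtAl2026, Cor. 1 (arXiv:2312.09301, §0.1, p. 4)] -/
theorem max_selmerCorank_eq_of_kolyvagin1991
    (hK2 : Kolyvagin1991_selmerCorank_of_kolyvaginClass_ne_zero)
    (W : WeierstrassCurve ℚ) [W.IsElliptic] [W.IsGloballyMinimal] (p : ℕ) [hp : Fact p.Prime]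
    (hp5 : 5 ≤ p) (hgood : W.HasGoodReductionAtPrime p) (hsurj : W.HasSurjectiveModNGaloisRep p)
    (K : Type) [Field K] [NumberField K] (hK : IsImaginaryQuadratic K) [NeZero (W.conductorNorm ℤ)]
    (hHN : SatisfiesHeegnerHypothesis (W.conductorNorm ℤ) K) (hodd : Odd (NumberField.discr K))
    (hne3 : NumberField.discr K ≠ -3) (hHp : SatisfiesHeegnerHypothesis p K)
    (Dt : ModularParametrizationData W (W.conductorNorm ℤ)) (β : ℤ) (ι : K →+* ℂ) (n : ℕ)
    (d : KolyvaginHeegnerData Dt β ι n) (M : ℕ)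
    (hn : KolyvaginDescent.KolSupp (Zhang2014.IsKolyvaginPrime (W.conductorNorm ℤ) W K p) n)
    (hM : 1 ≤ M) (hMle : (M : ℕ∞) ≤ Zhang2014.levelIndex W p n)
    (hne : d.kolyvaginClass hp.out M ≠ 0)
    (hmin : ∀ (n' : ℕ) (d' : KolyvaginHeegnerData Dt β ι n') (M' : ℕ),
      KolyvaginDescent.KolSupp (Zhang2014.IsKolyvaginPrime (W.conductorNorm ℤ) W K p) n' →
      1 ≤ M' → (M' : ℕ∞) ≤ Zhang2014.levelIndex W p n' → d'.kolyvaginClass hp.out M' ≠ 0 →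
      n.primeFactors.card ≤ n'.primeFactors.card) :
    max (W.selmerCorank p) ((W.quadraticTwist (NumberField.discr K : ℚ)).selmerCorank p) =
      n.primeFactors.card + 1 := by
  have hpP : p.Prime := hp.out
  have hne4 : NumberField.discr K ≠ -4 := by
    have := Int.odd_iff.mp hodd
    omega
  have hpd : ¬ ((p : ℤ) ∣ NumberField.discr K) :=
    Literature.SatisfiesHeegnerHypothesis.not_dvd_discr hK.1 hHp hpP dvd_rfl
  have hpN : ¬ (p ∣ W.conductorNorm ℤ) := not_dvd_conductorNorm_of_hasGoodReductionAtPrime W hgood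
  rcases hK2 W p hp5 hsurj K hK hne3 hne4 hpd hpN hHN Dt β ι n d M hn hM hMle hne hmin with
    ⟨h1, h2, -⟩ | ⟨h1, h2, -⟩
  · rw [max_eq_left (by omega), h1]
  · rw [max_eq_right (by omega), h1]

/-! ## Part 2. BCGS Cor. 1, rank-one display, from Thm. 1 + the Cor. 1 formula + Gross–Zagier -/

section CorOne

/-- **Burungale–Castella–Grossi–Skinner 2026, Cor. 1, rank-one case — `corank_{ℤ_p} Sel_{p^∞}(E/K)
= 1 ⟹ ord_{s=1} L(E/K, s) = 1` for EVERY `E/ℚ` under (irr), (tor), `p > 3` — along its printed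
proof**, from BCGS Thm. 1 (`hK1`, the named fact `BurungaleEtAl2026_exists_kolyvaginClass_ne_zero`),
the formula of Cor. 1 under the hypotheses of Thm. 1 (`hCor1`, inline: at a non-zero class of
minimal depth `max{c, c'} = ν + 1`), the Gross–Zagier corollary over `K` (`hGZ`,
`analyticRankEK_eq_one_iff_heegner_nonTorsion`) and Shimura reciprocity at conductor `1` (`hrec`,
`heegnerPointOfConductor_one_galoisConj`). Proof (BCGS §0.1, p. 4):
`corank_p Sel(E/K) = c + c'` (`selmerCorank_baseChange_quadratic_holds`, Dokchitser–Dokchitser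
2010, Lem. 4.14) `= 1`; the bottom class `c_M(1) ≠ 0`
(`heegnerSystem_exists_kolyvaginClass_one_ne_zero_of_max_eq`); hence `ord_{s=1} L(E/K, s) = 1`
(`heegnerSystem_analyticRankEK_eq_one_of_kolyvaginClass_one_ne_zero`). The conclusion is the
inline `K`-level leaf `hBCGS` of `BSDSelmerCMPConverseHeegnerFieldProofs` (Part 3) and of
`BSDSelmerPConverseYanZhuProofs` (`…_of_bcgs`), verbatim.
[cite: BurungaleEtAl2026, Thm. 1 and Cor. 1 (arXiv:2312.09301, §0.1, pp. 3–4)]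
[cite: GrossZagier1986, Thm. I.6.3 with V.§2] [cite: GrossLMS1991, §4 (4.1), Prop. 4.7 (1)] -/
theorem burungaleEtAl2026_analyticRankEK_eq_one_of_selmerCorank_eq_one_of_cor1
    (hK1 : BurungaleEtAl2026_exists_kolyvaginClass_ne_zero)
    (hCor1 : ∀ (W : WeierstrassCurve ℚ) [W.IsElliptic] [W.IsGloballyMinimal] (p : ℕ)
      [hp : Fact p.Prime], 3 < p → W.HasGoodReductionAtPrime p → ¬ (p : ℤ) ∣ W.frobeniusTrace p →
      W.HasIrreducibleModPGaloisRep p →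
      ∀ (K : Type) [Field K] [NumberField K], IsImaginaryQuadratic K →
        ∀ [NeZero (W.conductorNorm ℤ)], SatisfiesHeegnerHypothesis (W.conductorNorm ℤ) K →
        Odd (NumberField.discr K) → NumberField.discr K ≠ -3 →
        AddSubgroup.torsionBy (W.baseChange K).toAffine.Point (p : ℤ) = ⊥ →
        SatisfiesHeegnerHypothesis p K →
        ∀ (Dt : ModularParametrizationData W (W.conductorNorm ℤ)) (β : ℤ) (ι : K →+* ℂ) (n : ℕ)
          (d : KolyvaginHeegnerData Dt β ι n) (M : ℕ),
          KolyvaginDescent.KolSupp (Zhang2014.IsKolyvaginPrime (W.conductorNorm ℤ) W K p) n →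
          1 ≤ M → (M : ℕ∞) ≤ Zhang2014.levelIndex W p n → d.kolyvaginClass hp.out M ≠ 0 →
          (∀ (n' : ℕ) (d' : KolyvaginHeegnerData Dt β ι n') (M' : ℕ),
            KolyvaginDescent.KolSupp (Zhang2014.IsKolyvaginPrime (W.conductorNorm ℤ) W K p) n' →
            1 ≤ M' → (M' : ℕ∞) ≤ Zhang2014.levelIndex W p n' → d'.kolyvaginClass hp.out M' ≠ 0 →
            n.primeFactors.card ≤ n'.primeFactors.card) →
          max (W.selmerCorank p) ((W.quadraticTwist (NumberField.discr K : ℚ)).selmerCorank p) =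
            n.primeFactors.card + 1)
    (hGZ : ∀ (W : WeierstrassCurve ℚ) (N : ℕ) [NeZero N] (K : Type) [Field K] [NumberField K],
      analyticRankEK_eq_one_iff_heegner_nonTorsion W N K)
    (hrec : ∀ (N : ℕ) [NeZero N] (W : WeierstrassCurve ℚ) (K : Type) [Field K] [NumberField K],
      heegnerPointOfConductor_one_galoisConj N W K) :
    ∀ (W : WeierstrassCurve ℚ) [W.IsElliptic] [W.IsGloballyMinimal] (p : ℕ) [Fact p.Prime],
      3 < p → W.HasGoodReductionAtPrime p → ¬ (p : ℤ) ∣ W.frobeniusTrace p →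
      W.HasIrreducibleModPGaloisRep p →
      ∀ (K : Type) [Field K] [NumberField K], IsImaginaryQuadratic K →
        SatisfiesHeegnerHypothesis (W.conductorNorm ℤ) K →
        Odd (NumberField.discr K) → NumberField.discr K ≠ -3 →
        AddSubgroup.torsionBy (W.baseChange K).toAffine.Point (p : ℤ) = ⊥ →
        SatisfiesHeegnerHypothesis p K →
        (W.baseChange K).selmerCorank p = 1 → analyticRankEK W K = 1 := by
  intro W _ _ p hp hp3 hgood hord hirr K _ _ hK hHN hodd hne3 htor hHp hcK
  haveI : NeZero (W.conductorNorm ℤ) := ⟨(W.conductorNorm_pos_holds).ne'⟩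
  have hcc : W.selmerCorank p + (W.quadraticTwist (NumberField.discr K : ℚ)).selmerCorank p =
      1 := by
    rw [← selmerCorank_baseChange_quadratic_holds W K hK.1 p]
    exact hcK
  obtain ⟨Dt, β, ι, d, M, -, hne⟩ :=
    heegnerSystem_exists_kolyvaginClass_one_ne_zero_of_max_eq hp.out
      (hK1 W p hp3 hgood hord hirr K hK hHN hodd hne3 htor hHp)
      (hCor1 W p hp3 hgood hord hirr K hK hHN hodd hne3 htor hHp) hcc
  exact heegnerSystem_analyticRankEK_eq_one_of_kolyvaginClass_one_ne_zero (hGZ W _ K) (hrec _ W K)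
    hK rfl hHN d hne

/-- **The same for CM curves, from the CM instances of the Cor. 1 formula** (`hCor1_CM`: the
formula of BCGS Cor. 1 at a non-zero class of minimal depth, for `W` with complex multiplication
under the hypotheses of Thm. 1, `p > 3`, (irr), (tor)). The conclusion is the CM-restricted leaf
`hBCGS_CM` of `BSDSelmerCMPConverseKLevelProofs` (Parts 3, 4, 7, 8), verbatim. For a CM curve
BCGS's pointer to Kolyvagin's structure theorem goes beyond its letter (`ℓ ∈ B(E)`, i.e. `ρ̄_{E,p}`
onto, fails: `not_hasSurjectiveModNGaloisRep_of_hasCM_of_not_dvd_frobeniusTrace`); the formula is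
taken as printed in Cor. 1, "for `E`, `p` and `K` as in Theorem 1".
[cite: BurungaleEtAl2026, Thm. 1 and Cor. 1 (arXiv:2312.09301, §0.1, pp. 3–4)]
[cite: GrossZagier1986, Thm. I.6.3 with V.§2] [cite: GrossLMS1991, §2 (p. 237) and §4] -/
theorem burungaleEtAl2026_analyticRankEK_eq_one_of_hasCM_of_selmerCorank_eq_one_of_cor1CM
    (hK1 : BurungaleEtAl2026_exists_kolyvaginClass_ne_zero)
    (hCor1_CM : ∀ (W : WeierstrassCurve ℚ) [W.IsElliptic] [W.IsGloballyMinimal], W.HasCM →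
      ∀ (p : ℕ) [hp : Fact p.Prime], 3 < p → W.HasGoodReductionAtPrime p →
      ¬ (p : ℤ) ∣ W.frobeniusTrace p → W.HasIrreducibleModPGaloisRep p →
      ∀ (K : Type) [Field K] [NumberField K], IsImaginaryQuadratic K →
        ∀ [NeZero (W.conductorNorm ℤ)], SatisfiesHeegnerHypothesis (W.conductorNorm ℤ) K →
        Odd (NumberField.discr K) → NumberField.discr K ≠ -3 →
        AddSubgroup.torsionBy (W.baseChange K).toAffine.Point (p : ℤ) = ⊥ →
        SatisfiesHeegnerHypothesis p K →
        ∀ (Dt : ModularParametrizationData W (W.conductorNorm ℤ)) (β : ℤ) (ι : K →+* ℂ) (n : ℕ)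
          (d : KolyvaginHeegnerData Dt β ι n) (M : ℕ),
          KolyvaginDescent.KolSupp (Zhang2014.IsKolyvaginPrime (W.conductorNorm ℤ) W K p) n →
          1 ≤ M → (M : ℕ∞) ≤ Zhang2014.levelIndex W p n → d.kolyvaginClass hp.out M ≠ 0 →
          (∀ (n' : ℕ) (d' : KolyvaginHeegnerData Dt β ι n') (M' : ℕ),
            KolyvaginDescent.KolSupp (Zhang2014.IsKolyvaginPrime (W.conductorNorm ℤ) W K p) n' →
            1 ≤ M' → (M' : ℕ∞) ≤ Zhang2014.levelIndex W p n' → d'.kolyvaginClass hp.out M' ≠ 0 →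
            n.primeFactors.card ≤ n'.primeFactors.card) →
          max (W.selmerCorank p) ((W.quadraticTwist (NumberField.discr K : ℚ)).selmerCorank p) =
            n.primeFactors.card + 1)
    (hGZ : ∀ (W : WeierstrassCurve ℚ) (N : ℕ) [NeZero N] (K : Type) [Field K] [NumberField K],
      analyticRankEK_eq_one_iff_heegner_nonTorsion W N K)
    (hrec : ∀ (N : ℕ) [NeZero N] (W : WeierstrassCurve ℚ) (K : Type) [Field K] [NumberField K],
      heegnerPointOfConductor_one_galoisConj N W K) :
    ∀ (W : WeierstrassCurve ℚ) [W.IsElliptic] [W.IsGloballyMinimal], W.HasCM →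
      ∀ (p : ℕ) [Fact p.Prime],
      3 < p → W.HasGoodReductionAtPrime p → ¬ (p : ℤ) ∣ W.frobeniusTrace p →
      W.HasIrreducibleModPGaloisRep p →
      ∀ (K : Type) [Field K] [NumberField K], IsImaginaryQuadratic K →
        SatisfiesHeegnerHypothesis (W.conductorNorm ℤ) K →
        Odd (NumberField.discr K) → NumberField.discr K ≠ -3 →
        AddSubgroup.torsionBy (W.baseChange K).toAffine.Point (p : ℤ) = ⊥ →
        SatisfiesHeegnerHypothesis p K →
        (W.baseChange K).selmerCorank p = 1 → analyticRankEK W K = 1 := by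
  intro W _ _ hCM p hp hp3 hgood hord hirr K _ _ hK hHN hodd hne3 htor hHp hcK
  haveI : NeZero (W.conductorNorm ℤ) := ⟨(W.conductorNorm_pos_holds).ne'⟩
  have hcc : W.selmerCorank p + (W.quadraticTwist (NumberField.discr K : ℚ)).selmerCorank p =
      1 := by
    rw [← selmerCorank_baseChange_quadratic_holds W K hK.1 p]
    exact hcK
  obtain ⟨Dt, β, ι, d, M, -, hne⟩ :=
    heegnerSystem_exists_kolyvaginClass_one_ne_zero_of_max_eq hp.out
      (hK1 W p hp3 hgood hord hirr K hK hHN hodd hne3 htor hHp)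
      (hCor1_CM W hCM p hp3 hgood hord hirr K hK hHN hodd hne3 htor hHp) hcc
  exact heegnerSystem_analyticRankEK_eq_one_of_kolyvaginClass_one_ne_zero (hGZ W _ K) (hrec _ W K)
    hK rfl hHN d hne

end CorOne

/-! ## Part 3. Burungale–Tian's Thm. 1.2 from eight named facts + the Cor. 1 formula for CM -/

section Assembly

/-- **Burungale–Tian, Thm. 1.2, along route B and the printed proof of BCGS Cor. 1, from NAMED
FACTS of the tree and the Cor. 1 formula for CM curves.** Inputs: Nekovář's `p`-parity theorem
(`hN`, `Nekovar2013_theoremA`; printed input (4.2), "[31, Thm. A′]"), the Modularity Theorem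
(`hmod`), Hoffstein–Luo (`hHL`, the auxiliary field with `d_K ≡ 1 (mod 8)`, `p` split and
`L(E^{(d_K)}, 1) ≠ 0`; printed (4.3)), Coates–Wiles + Rubin 1987 (`hCW`, `hRu`: the twist has
corank `0`; printed (4.4)), BCGS Thm. 1 (`hK1`), the Gross–Zagier corollary over `K` (`hGZ`),
Shimura reciprocity at conductor `1` (`hrec`), and the formula of BCGS Cor. 1 for CM curves
(`hCor1_CM`, inline). Proof: `BSDSelmerCMPConverseKLevelProofs`'s
`burungaleTian_…_of_hasCM_of_bcgsCM_of_nekovar` with its leaf `hBCGS_CM` supplied by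
`burungaleEtAl2026_analyticRankEK_eq_one_of_hasCM_of_selmerCorank_eq_one_of_cor1CM`. Along this
road the fact rests on eight named facts and ONE inline input, the structure statement of Cor. 1
for CM curves.
[cite: BurungaleTian2019, Thm. 1.2 (p. 214) and §4.2.3, displays (4.2)–(4.4) (p. 249)]
[cite: BurungaleEtAl2026, Thm. 1 and Cor. 1 (arXiv:2312.09301, §0.1, pp. 3–4)]
[cite: Nekovar2013, Thm. A (p. 1101)] [cite: HoffsteinLuo1997, Theorem (§1, pp. 435–436)]
[cite: CoatesWiles1977, Thm 1] [cite: Rubin1987Sha, Thm. A (p. 527)]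
[cite: GrossZagier1986, Thm. I.6.3 with V.§2] -/
theorem burungaleTian_analyticRank_eq_one_of_selmerCorank_eq_one_of_hasCM_of_cor1CM_of_nekovar
    (hN : Nekovar2013_theoremA) (hmod : ModularForms.exists_isNewformOf)
    (hHL : HoffsteinLuo1997_exists_twist_L_one_ne_zero)
    (hCW : finite_point_of_hasCM_of_L_one_ne_zero) (hRu : shaFinite_of_hasCM_of_L_one_ne_zero)
    (hK1 : BurungaleEtAl2026_exists_kolyvaginClass_ne_zero)
    (hGZ : ∀ (W : WeierstrassCurve ℚ) (N : ℕ) [NeZero N] (K : Type) [Field K] [NumberField K],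
      analyticRankEK_eq_one_iff_heegner_nonTorsion W N K)
    (hrec : ∀ (N : ℕ) [NeZero N] (W : WeierstrassCurve ℚ) (K : Type) [Field K] [NumberField K],
      heegnerPointOfConductor_one_galoisConj N W K)
    (hCor1_CM : ∀ (W : WeierstrassCurve ℚ) [W.IsElliptic] [W.IsGloballyMinimal], W.HasCM →
      ∀ (p : ℕ) [hp : Fact p.Prime], 3 < p → W.HasGoodReductionAtPrime p →
      ¬ (p : ℤ) ∣ W.frobeniusTrace p → W.HasIrreducibleModPGaloisRep p →
      ∀ (K : Type) [Field K] [NumberField K], IsImaginaryQuadratic K →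
        ∀ [NeZero (W.conductorNorm ℤ)], SatisfiesHeegnerHypothesis (W.conductorNorm ℤ) K →
        Odd (NumberField.discr K) → NumberField.discr K ≠ -3 →
        AddSubgroup.torsionBy (W.baseChange K).toAffine.Point (p : ℤ) = ⊥ →
        SatisfiesHeegnerHypothesis p K →
        ∀ (Dt : ModularParametrizationData W (W.conductorNorm ℤ)) (β : ℤ) (ι : K →+* ℂ) (n : ℕ)
          (d : KolyvaginHeegnerData Dt β ι n) (M : ℕ),
          KolyvaginDescent.KolSupp (Zhang2014.IsKolyvaginPrime (W.conductorNorm ℤ) W K p) n →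
          1 ≤ M → (M : ℕ∞) ≤ Zhang2014.levelIndex W p n → d.kolyvaginClass hp.out M ≠ 0 →
          (∀ (n' : ℕ) (d' : KolyvaginHeegnerData Dt β ι n') (M' : ℕ),
            KolyvaginDescent.KolSupp (Zhang2014.IsKolyvaginPrime (W.conductorNorm ℤ) W K p) n' →
            1 ≤ M' → (M' : ℕ∞) ≤ Zhang2014.levelIndex W p n' → d'.kolyvaginClass hp.out M' ≠ 0 →
            n.primeFactors.card ≤ n'.primeFactors.card) →
          max (W.selmerCorank p) ((W.quadraticTwist (NumberField.discr K : ℚ)).selmerCorank p) =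
            n.primeFactors.card + 1) :
    burungaleTian_analyticRank_eq_one_of_selmerCorank_eq_one_of_hasCM :=
  burungaleTian_analyticRank_eq_one_of_selmerCorank_eq_one_of_hasCM_of_bcgsCM_of_nekovar hN hmod
    hHL hCW hRu
    (burungaleEtAl2026_analyticRankEK_eq_one_of_hasCM_of_selmerCorank_eq_one_of_cor1CM hK1
      hCor1_CM hGZ hrec)

/-- **The same with the Gross–Zagier FORMULA as the analytic leaf**: `gross_zagier N W K`
(Gross–Zagier 1986, Thm. I.6.3) and Modularity give the corollary
`analyticRankEK_eq_one_iff_heegner_nonTorsion W N K`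
(`analyticRankEK_eq_one_iff_heegner_nonTorsion_of_exists_isNewformOf`). So along this road the fact
rests on: Nekovář's parity theorem, Modularity, Hoffstein–Luo, Coates–Wiles, Rubin 1987, BCGS
Thm. 1, the Gross–Zagier formula, Shimura reciprocity at conductor `1` — and the Cor. 1 formula for
CM curves. [cite: BurungaleTian2019, Thm. 1.2 (p. 214)]
[cite: BurungaleEtAl2026, Thm. 1 and Cor. 1 (arXiv:2312.09301, §0.1, pp. 3–4)]
[cite: GrossZagier1986, Thm. I.6.3 with V.§2] -/
theorem burungaleTian_analyticRank_eq_one_of_selmerCorank_eq_one_of_hasCM_of_cor1CM_of_gross_zagier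
    (hN : Nekovar2013_theoremA) (hmod : ModularForms.exists_isNewformOf)
    (hHL : HoffsteinLuo1997_exists_twist_L_one_ne_zero)
    (hCW : finite_point_of_hasCM_of_L_one_ne_zero) (hRu : shaFinite_of_hasCM_of_L_one_ne_zero)
    (hK1 : BurungaleEtAl2026_exists_kolyvaginClass_ne_zero)
    (hGZ : ∀ (N : ℕ) [NeZero N] (W : WeierstrassCurve ℚ) (K : Type) [Field K] [NumberField K],
      gross_zagier N W K)
    (hrec : ∀ (N : ℕ) [NeZero N] (W : WeierstrassCurve ℚ) (K : Type) [Field K] [NumberField K],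
      heegnerPointOfConductor_one_galoisConj N W K)
    (hCor1_CM : ∀ (W : WeierstrassCurve ℚ) [W.IsElliptic] [W.IsGloballyMinimal], W.HasCM →
      ∀ (p : ℕ) [hp : Fact p.Prime], 3 < p → W.HasGoodReductionAtPrime p →
      ¬ (p : ℤ) ∣ W.frobeniusTrace p → W.HasIrreducibleModPGaloisRep p →
      ∀ (K : Type) [Field K] [NumberField K], IsImaginaryQuadratic K →
        ∀ [NeZero (W.conductorNorm ℤ)], SatisfiesHeegnerHypothesis (W.conductorNorm ℤ) K →
        Odd (NumberField.discr K) → NumberField.discr K ≠ -3 →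
        AddSubgroup.torsionBy (W.baseChange K).toAffine.Point (p : ℤ) = ⊥ →
        SatisfiesHeegnerHypothesis p K →
        ∀ (Dt : ModularParametrizationData W (W.conductorNorm ℤ)) (β : ℤ) (ι : K →+* ℂ) (n : ℕ)
          (d : KolyvaginHeegnerData Dt β ι n) (M : ℕ),
          KolyvaginDescent.KolSupp (Zhang2014.IsKolyvaginPrime (W.conductorNorm ℤ) W K p) n →
          1 ≤ M → (M : ℕ∞) ≤ Zhang2014.levelIndex W p n → d.kolyvaginClass hp.out M ≠ 0 →
          (∀ (n' : ℕ) (d' : KolyvaginHeegnerData Dt β ι n') (M' : ℕ),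
            KolyvaginDescent.KolSupp (Zhang2014.IsKolyvaginPrime (W.conductorNorm ℤ) W K p) n' →
            1 ≤ M' → (M' : ℕ∞) ≤ Zhang2014.levelIndex W p n' → d'.kolyvaginClass hp.out M' ≠ 0 →
            n.primeFactors.card ≤ n'.primeFactors.card) →
          max (W.selmerCorank p) ((W.quadraticTwist (NumberField.discr K : ℚ)).selmerCorank p) =
            n.primeFactors.card + 1) :
    burungaleTian_analyticRank_eq_one_of_selmerCorank_eq_one_of_hasCM :=
  burungaleTian_analyticRank_eq_one_of_selmerCorank_eq_one_of_hasCM_of_cor1CM_of_nekovar hN hmod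
    hHL hCW hRu hK1
    (fun W N _ K _ _ ↦
      analyticRankEK_eq_one_iff_heegner_nonTorsion_of_exists_isNewformOf W N K (hGZ N W K) hmod)
    hrec hCor1_CM

/-- **The variant over the leaf set of route B's first assembly** (`…HeegnerFieldProofs`, Part 3;
`…KLevelProofs`, Part 3): parity as the tree's `p_parity` (`hpar`, Dokchitser–Dokchitser 2010,
Thm. 1.4) and Kato's finiteness theorem for the twist (`hKato`) in place of Nekovář and
Coates–Wiles + Rubin; the leaf `hBCGS_CM` again from BCGS Thm. 1, the Cor. 1 formula for CM
curves, Gross–Zagier and reciprocity. [cite: BurungaleTian2019, Thm. 1.2 (p. 214)]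
[cite: BurungaleEtAl2026, Thm. 1 and Cor. 1 (arXiv:2312.09301, §0.1, pp. 3–4)]
[cite: DokchitserDokchitserAnnals2010, Thm. 1.4] [cite: Kato2004Asterisque, Cor. 14.3 (p. 235)] -/
theorem burungaleTian_analyticRank_eq_one_of_selmerCorank_eq_one_of_hasCM_of_cor1CM
    (hpar : ∀ (W : WeierstrassCurve ℚ) [W.IsElliptic] (p : ℕ) [Fact p.Prime], p_parity W p)
    (hmod : ModularForms.exists_isNewformOf) (hHL : HoffsteinLuo1997_exists_twist_L_one_ne_zero)
    (hKato : ∀ (W : WeierstrassCurve ℚ) [W.IsElliptic] (p : ℕ) [Fact p.Prime],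
      kato_finite_of_L_one_ne_zero W p)
    (hK1 : BurungaleEtAl2026_exists_kolyvaginClass_ne_zero)
    (hGZ : ∀ (W : WeierstrassCurve ℚ) (N : ℕ) [NeZero N] (K : Type) [Field K] [NumberField K],
      analyticRankEK_eq_one_iff_heegner_nonTorsion W N K)
    (hrec : ∀ (N : ℕ) [NeZero N] (W : WeierstrassCurve ℚ) (K : Type) [Field K] [NumberField K],
      heegnerPointOfConductor_one_galoisConj N W K)
    (hCor1_CM : ∀ (W : WeierstrassCurve ℚ) [W.IsElliptic] [W.IsGloballyMinimal], W.HasCM →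
      ∀ (p : ℕ) [hp : Fact p.Prime], 3 < p → W.HasGoodReductionAtPrime p →
      ¬ (p : ℤ) ∣ W.frobeniusTrace p → W.HasIrreducibleModPGaloisRep p →
      ∀ (K : Type) [Field K] [NumberField K], IsImaginaryQuadratic K →
        ∀ [NeZero (W.conductorNorm ℤ)], SatisfiesHeegnerHypothesis (W.conductorNorm ℤ) K →
        Odd (NumberField.discr K) → NumberField.discr K ≠ -3 →
        AddSubgroup.torsionBy (W.baseChange K).toAffine.Point (p : ℤ) = ⊥ →
        SatisfiesHeegnerHypothesis p K →
        ∀ (Dt : ModularParametrizationData W (W.conductorNorm ℤ)) (β : ℤ) (ι : K →+* ℂ) (n : ℕ)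
          (d : KolyvaginHeegnerData Dt β ι n) (M : ℕ),
          KolyvaginDescent.KolSupp (Zhang2014.IsKolyvaginPrime (W.conductorNorm ℤ) W K p) n →
          1 ≤ M → (M : ℕ∞) ≤ Zhang2014.levelIndex W p n → d.kolyvaginClass hp.out M ≠ 0 →
          (∀ (n' : ℕ) (d' : KolyvaginHeegnerData Dt β ι n') (M' : ℕ),
            KolyvaginDescent.KolSupp (Zhang2014.IsKolyvaginPrime (W.conductorNorm ℤ) W K p) n' →
            1 ≤ M' → (M' : ℕ∞) ≤ Zhang2014.levelIndex W p n' → d'.kolyvaginClass hp.out M' ≠ 0 →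
            n.primeFactors.card ≤ n'.primeFactors.card) →
          max (W.selmerCorank p) ((W.quadraticTwist (NumberField.discr K : ℚ)).selmerCorank p) =
            n.primeFactors.card + 1) :
    burungaleTian_analyticRank_eq_one_of_selmerCorank_eq_one_of_hasCM :=
  burungaleTian_analyticRank_eq_one_of_selmerCorank_eq_one_of_hasCM_of_bcgsCM hpar hmod hHL hKato
    (burungaleEtAl2026_analyticRankEK_eq_one_of_hasCM_of_selmerCorank_eq_one_of_cor1CM hK1
      hCor1_CM hGZ hrec)

/-- **The variant with the general Cor. 1 formula** (`hCor1`: for every `E/ℚ` as in BCGS Thm. 1,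
`p > 3`, (irr), not only CM curves): the fact from Nekovář, Modularity, Hoffstein–Luo,
Coates–Wiles, Rubin 1987, BCGS Thm. 1, Gross–Zagier, reciprocity and `hCor1`, by restriction of
`hCor1` to CM curves. [cite: BurungaleTian2019, Thm. 1.2 (p. 214)]
[cite: BurungaleEtAl2026, Thm. 1 and Cor. 1 (arXiv:2312.09301, §0.1, pp. 3–4)] -/
theorem burungaleTian_analyticRank_eq_one_of_selmerCorank_eq_one_of_hasCM_of_cor1_of_nekovar
    (hN : Nekovar2013_theoremA) (hmod : ModularForms.exists_isNewformOf)
    (hHL : HoffsteinLuo1997_exists_twist_L_one_ne_zero)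
    (hCW : finite_point_of_hasCM_of_L_one_ne_zero) (hRu : shaFinite_of_hasCM_of_L_one_ne_zero)
    (hK1 : BurungaleEtAl2026_exists_kolyvaginClass_ne_zero)
    (hGZ : ∀ (W : WeierstrassCurve ℚ) (N : ℕ) [NeZero N] (K : Type) [Field K] [NumberField K],
      analyticRankEK_eq_one_iff_heegner_nonTorsion W N K)
    (hrec : ∀ (N : ℕ) [NeZero N] (W : WeierstrassCurve ℚ) (K : Type) [Field K] [NumberField K],
      heegnerPointOfConductor_one_galoisConj N W K)
    (hCor1 : ∀ (W : WeierstrassCurve ℚ) [W.IsElliptic] [W.IsGloballyMinimal] (p : ℕ)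
      [hp : Fact p.Prime], 3 < p → W.HasGoodReductionAtPrime p → ¬ (p : ℤ) ∣ W.frobeniusTrace p →
      W.HasIrreducibleModPGaloisRep p →
      ∀ (K : Type) [Field K] [NumberField K], IsImaginaryQuadratic K →
        ∀ [NeZero (W.conductorNorm ℤ)], SatisfiesHeegnerHypothesis (W.conductorNorm ℤ) K →
        Odd (NumberField.discr K) → NumberField.discr K ≠ -3 →
        AddSubgroup.torsionBy (W.baseChange K).toAffine.Point (p : ℤ) = ⊥ →
        SatisfiesHeegnerHypothesis p K →
        ∀ (Dt : ModularParametrizationData W (W.conductorNorm ℤ)) (β : ℤ) (ι : K →+* ℂ) (n : ℕ)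
          (d : KolyvaginHeegnerData Dt β ι n) (M : ℕ),
          KolyvaginDescent.KolSupp (Zhang2014.IsKolyvaginPrime (W.conductorNorm ℤ) W K p) n →
          1 ≤ M → (M : ℕ∞) ≤ Zhang2014.levelIndex W p n → d.kolyvaginClass hp.out M ≠ 0 →
          (∀ (n' : ℕ) (d' : KolyvaginHeegnerData Dt β ι n') (M' : ℕ),
            KolyvaginDescent.KolSupp (Zhang2014.IsKolyvaginPrime (W.conductorNorm ℤ) W K p) n' →
            1 ≤ M' → (M' : ℕ∞) ≤ Zhang2014.levelIndex W p n' → d'.kolyvaginClass hp.out M' ≠ 0 →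
            n.primeFactors.card ≤ n'.primeFactors.card) →
          max (W.selmerCorank p) ((W.quadraticTwist (NumberField.discr K : ℚ)).selmerCorank p) =
            n.primeFactors.card + 1) :
    burungaleTian_analyticRank_eq_one_of_selmerCorank_eq_one_of_hasCM :=
  burungaleTian_analyticRank_eq_one_of_selmerCorank_eq_one_of_hasCM_of_cor1CM_of_nekovar hN hmod
    hHL hCW hRu hK1 hGZ hrec (fun W _ _ _ p _ ↦ hCor1 W p)

end Assembly

end Literature.NumberTheory.EllipticCurves

end
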